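import Summits.CriticalPhenomena.CardyFormulaZ2.Theorems.CardyFlipRussoSquareFromVoronoiHubProductLegDefs
import Literature.Probability.LatticeModels.DelaunayGraph
import HarnessLib

/-!
# The Delaunay diagonal orientation of a face of the jittered square lattice is fair

Helper for crux stmt-CriticalPhenomena-6434
(`Summit.CriticalPhenomena.CardyFormulaZ2.Theses.CardyFlipRusso.SquareFromVoronoiHub`), line
`SketchIdeator5R2`, stub `stub_diagonal_reflection_symm`: under the i.i.d. isotropic jitters
`ξ_u ~ jitterLaw` the SW–NE and the SE–NW diagonal of the face with lower-left corner `v` of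
`ℤ² + ξ` are Delaunay pairs with the same probability.  Proof: reflecting the sites in the vertical
line `x = v.1 + 1/2` and every jitter in the imaginary axis is a measure-preserving bijection of
the jitter field whose preimage of the SW–NE event is the SE–NW event (isometry equivariance of
the empty-ball rule); no measurability of the events is needed.
-/

noncomputable section

open MeasureTheory
open Literature.Probability.LatticeModels (IsDelaunayPair)

namespace Summit.CriticalPhenomena.CardyFormulaZ2.Cruxes.SquareFromVoronoiHub.ProductLeg

/-- The site map `(x, y) ↦ (2a + 1 - x, y)` (reflection of `ℤ²` in the vertical line
`x = a + 1/2`) is an involution. [folklore] -/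
private theorem siteRefl_involutive (a : ℤ) :
    Function.Involutive fun u : ℤ × ℤ => (2 * a + 1 - u.1, u.2) := fun u =>
  Prod.ext (by dsimp only; ring) rfl

/-- The single-site jitter law (Lebesgue measure conditioned on a disc centred at `0`) is
invariant under every real linear isometry of `ℂ` (it preserves Lebesgue measure and the disc).
[folklore] -/
private theorem jitterLaw_map_linearIsometryEquiv (ρ : ℂ ≃ₗᵢ[ℝ] ℂ) :
    jitterLaw.map ρ = jitterLaw := by
  have hρ : MeasurePreserving ρ volume volume := ρ.measurePreserving
  have hpre : ρ ⁻¹' Metric.closedBall (0 : ℂ) jitterRadius =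
      Metric.closedBall (0 : ℂ) jitterRadius := by
    rw [LinearIsometryEquiv.preimage_closedBall, map_zero]
  have hres := (hρ.restrict_preimage (s := Metric.closedBall (0 : ℂ) jitterRadius)
    Metric.isClosed_closedBall.measurableSet).map_eq
  rw [hpre] at hres
  unfold jitterLaw ProbabilityTheory.cond
  rw [Measure.map_smul, hres]

/-- Reindexing the jitter field along a permutation `σ` of the sites and then applying a real
linear isometry `ρ` of `ℂ` to every jitter preserves the product jitter law (reindexing:
`infinitePi_map_piCongrLeft`; coordinatewise map: `infinitePi_map_pi` and
`jitterLaw_map_linearIsometryEquiv`). [folklore] -/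
private theorem measurePreserving_fieldRefl (σ : ℤ × ℤ ≃ ℤ × ℤ) (ρ : ℂ ≃ₗᵢ[ℝ] ℂ) :
    MeasurePreserving
      ((MeasurableEquiv.piCongrLeft (fun _ : ℤ × ℤ => ℂ) σ).symm.trans
        (MeasurableEquiv.piCongrRight fun _ : ℤ × ℤ => ρ.toMeasurableEquiv))
      (Measure.infinitePi fun _ : ℤ × ℤ => jitterLaw)
      (Measure.infinitePi fun _ : ℤ × ℤ => jitterLaw) := by
  have h1 : MeasurePreserving (MeasurableEquiv.piCongrLeft (fun _ : ℤ × ℤ => ℂ) σ)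
      (Measure.infinitePi fun _ : ℤ × ℤ => jitterLaw)
      (Measure.infinitePi fun _ : ℤ × ℤ => jitterLaw) :=
    ⟨MeasurableEquiv.measurable _,
      Measure.infinitePi_map_piCongrLeft (X := fun _ : ℤ × ℤ => ℂ) (fun _ => jitterLaw) σ⟩
  have h2 : MeasurePreserving
      (MeasurableEquiv.piCongrRight fun _ : ℤ × ℤ => ρ.toMeasurableEquiv)
      (Measure.infinitePi fun _ : ℤ × ℤ => jitterLaw)
      (Measure.infinitePi fun _ : ℤ × ℤ => jitterLaw) := by
    refine ⟨MeasurableEquiv.measurable _, ?_⟩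
    have h := Measure.infinitePi_map_pi (X := fun _ : ℤ × ℤ => ℂ) (fun _ : ℤ × ℤ => jitterLaw)
      (f := fun _ : ℤ × ℤ => (ρ : ℂ → ℂ)) fun _ => ρ.continuous.measurable
    simp only [jitterLaw_map_linearIsometryEquiv] at h
    exact h
  exact h2.comp (h1.symm _)

/-- **Stub `stub_diagonal_reflection_symm` (line `SketchIdeator5R2`).** For the disc-jittered
square lattice `ℤ² + ξ` (`ξ_u` i.i.d. `~ jitterLaw`), the SW–NE diagonal
`{v + ξ v, v + (1,1) + ξ (v + (1,1))}` and the SE–NW diagonal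
`{v + (1,0) + ξ (v + (1,0)), v + (0,1) + ξ (v + (0,1))}` of the face with lower-left corner `v`
are Delaunay pairs (closed empty-ball rule) with the same probability: the Delaunay diagonal
field is fair.  The reflection `σ` of the sites in `x = v.1 + 1/2` together with the reflection
`ρ z = -conj z` of every jitter preserves the product law, and the jittered sites of the
transformed field are the images of the old ones under the plane reflection
`R z = 2 v.1 + 1 - conj z`, which swaps the two diagonals; the empty-ball rule is equivariant
under the isometry `R`. [folklore] -/
theorem stub_diagonal_reflection_symm :
    ∀ v : ℤ × ℤ,
      Measure.infinitePi (fun _ : ℤ × ℤ => jitterLaw)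
          {ξ | IsDelaunayPair (Set.range fun u : ℤ × ℤ => sqPos u + ξ u) (sqPos v + ξ v)
            (sqPos (v.1 + 1, v.2 + 1) + ξ (v.1 + 1, v.2 + 1))} =
        Measure.infinitePi (fun _ : ℤ × ℤ => jitterLaw)
          {ξ | IsDelaunayPair (Set.range fun u : ℤ × ℤ => sqPos u + ξ u)
            (sqPos (v.1 + 1, v.2) + ξ (v.1 + 1, v.2))
            (sqPos (v.1, v.2 + 1) + ξ (v.1, v.2 + 1))} := by
  intro v
  -- the site reflection `σ`, the jitter reflection `ρ`, the plane reflection `R`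
  obtain ⟨σ, hσ, hσσ⟩ : ∃ σ : ℤ × ℤ ≃ ℤ × ℤ,
      (∀ u, σ u = (2 * v.1 + 1 - u.1, u.2)) ∧ ∀ u, σ (σ u) = u :=
    ⟨Function.Involutive.toPerm _ (siteRefl_involutive v.1), fun _ => rfl,
      siteRefl_involutive v.1⟩
  obtain ⟨ρ, hρ⟩ : ∃ ρ : ℂ ≃ₗᵢ[ℝ] ℂ, ∀ z, ρ z = -(starRingEnd ℂ) z :=
    ⟨Complex.conjLIE.trans (LinearIsometryEquiv.neg ℝ), fun _ => rfl⟩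
  obtain ⟨R, hR⟩ : ∃ R : ℂ → ℂ, ∀ z, R z = (2 * (v.1 : ℂ) + 1) - (starRingEnd ℂ) z :=
    ⟨_, fun _ => rfl⟩
  -- the measure-preserving transformation `T ξ = ρ ∘ ξ ∘ σ` of the jitter field
  obtain ⟨T, hT, hTap⟩ : ∃ T : (ℤ × ℤ → ℂ) ≃ᵐ (ℤ × ℤ → ℂ),
      MeasurePreserving T (Measure.infinitePi fun _ : ℤ × ℤ => jitterLaw)
          (Measure.infinitePi fun _ : ℤ × ℤ => jitterLaw) ∧
        ∀ ξ u, T ξ u = ρ (ξ (σ u)) :=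
    ⟨_, measurePreserving_fieldRefl σ ρ, fun _ _ => rfl⟩
  -- geometry of `R`: an isometry, onto, and `R (sqPos u + w) = sqPos (σ u) + ρ w`
  have hdist : ∀ x y, dist (R x) (R y) = 1 * dist x y := fun x y => by
    rw [hR, hR, dist_sub_left, Complex.dist_conj_conj, one_mul]
  have hsurj : Function.Surjective R := Function.Involutive.surjective fun z => by
    rw [hR, hR]; apply Complex.ext <;> simp
  have hkey : ∀ (u : ℤ × ℤ) (w : ℂ), R (sqPos u + w) = sqPos (σ u) + ρ w := fun u w => by
    rw [hR, hσ, hρ]; apply Complex.ext <;> simp [sqPos] <;> ring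
  -- `μ SWNE = μ (T ⁻¹' SWNE)`, and `T ⁻¹' SWNE = SENW` pointwise
  refine ((hT.measure_preimage_equiv _).symm.trans ?_)
  congr 1
  ext ξ
  simp only [Set.mem_preimage, Set.mem_setOf_eq]
  have hpt : ∀ u, sqPos u + T ξ u = R (sqPos (σ u) + ξ (σ u)) := fun u => by
    rw [hTap, hkey, hσσ]
  have hrange : (Set.range fun u : ℤ × ℤ => sqPos u + T ξ u) =
      R '' Set.range fun u : ℤ × ℤ => sqPos u + ξ u := by
    have hcomp : (fun u : ℤ × ℤ => sqPos u + T ξ u) =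
        R ∘ (fun u : ℤ × ℤ => sqPos u + ξ u) ∘ σ := funext hpt
    rw [hcomp, Set.range_comp, EquivLike.range_comp]
  have hv1 : σ v = (v.1 + 1, v.2) := by
    rw [hσ]; exact Prod.ext (show 2 * v.1 + 1 - v.1 = v.1 + 1 by ring) rfl
  have hv2 : σ (v.1 + 1, v.2 + 1) = (v.1, v.2 + 1) := by
    rw [hσ]; exact Prod.ext (show 2 * v.1 + 1 - (v.1 + 1) = v.1 by ring) rfl
  rw [hrange, hpt v, hpt (v.1 + 1, v.2 + 1), hv1, hv2]
  exact Literature.Probability.LatticeModels.isDelaunayPair_image_iff one_pos hdist hsurj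

end Summit.CriticalPhenomena.CardyFormulaZ2.Cruxes.SquareFromVoronoiHub.ProductLeg

end
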